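import Summits.MatrixMultiplication.OmegaCensus.STPPVosperSlackTwoCheckersTP
import Summits.MatrixMultiplication.OmegaCensus.STPPVosperSlackTwoSoundAT

/-!
# ω-census (abelian STPP census): SOUNDNESS of the table-form slack-2 case-C checkers in normal form, any number of blocks (kernel tool)

HONEST FRAMING (pub-omega census; verbatim): lottery ticket; floor = certified bounds/negative ranges.
Census STRUCTURE (seat pub-omega-stpp-1 gen 33, 2026-08-28), family (b2).  Normal-form soundness of `caseCDeadT` (`STPPVosperSlackTwoCheckersT.lean`)
and of its pruned variant `caseCDeadTP` (`STPPVosperSlackTwoCheckersTP.lean`) in the PINNED-`Z°` gauge: an STPP family of `ℤ/p` with `N ≥ 2` non-empty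
blocks, block `i` with value lists `P` (of `A i`) and `Q` (of `B i`) — ANY duplicate-free lists with the right members —, case-C data `#T = b + z`,
`W ⊔ SY ⊔ T = ℤ/p`, and `Z° = ⋃_{k≠i}(C_k − A_k) = {0, 1, …, z} ∖ {h₀}` (`z + 1 ≤ p`), whose other blocks `ks` have sizes `szs`, with a table all of whose
entries are `CoverDead p N i szs`: the checker does NOT return `true` at `(Q, P, h₀)`.  The core (`false_of_caseCLeafT_all`) shows that the family passes
every stage — pattern packing, `|T|`-count of the mask `−Q + Zo`, the tiling `W = ⊔_{γ ∈ C i}(γ − A i − B i)` as an admissible choice of all `c` translates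
from the cover `T` (`admissible_filter_transMasks_all`), `SY = univ ∖ (W ∪ T)` by the partition, `Y° ⊆ Yc` and `−P + Y° = SY` as masks
(`Nat.eq_of_testBit_eq`), the prune `|Yc| ≥ L` at the final cover — so a leaf reached with the true `(Yo, Zo)` contradicts the table's deadness for the
family itself.  Pattern of stpp-1 g32's `caseCDeadQP'_false_of_normal_form_lists` (`STPPVosperSlackTwoSoundCList.lean`) minus the interval / hole loops
and the realisation stage.  UNCONDITIONAL; no `decide`.  Nothing here is progress on `ω`.

References: H. Cohn, R. Kleinberg, B. Szegedy, C. Umans, FOCS 2005 (arXiv:math/0511460), Def. 5.1; Y. O. Hamidoune, Ø. J. Rødseth, Acta Arith. 92 (2000).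
-/

open Finset
open scoped Pointwise

namespace Summit.MatrixMultiplication.OmegaCensus.CubeNB.S2

open Literature.Computability.AlgebraicComplexity
open Literature.Combinatorics.Additive
open Summit.MatrixMultiplication.OmegaCensus.STPPKneser
open Summit.MatrixMultiplication.OmegaCensus.CubeNB.Bits

variable {p : ℕ} [hp : Fact p.Prime]

/-- **Core of the case-C normal form.**  Under the normal-form hypotheses (module docstring), any "leaf guarantee" of the form produced by
`caseCLeafT_of_caseCDeadT` / `caseCLeafT_of_caseCDeadTP` — for every admissible choice of `c` translates from the cover `T` whose final cover is below
`2^p` and passes the prune, the leaf holds — is contradictory: the family's own tiling is such a choice and its leaf fails.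
[cite: CohnKleinbergSzegedyUmans2005, Def. 5.1] [cite: HamidouneRodseth2000, main theorem (§1, p. 252)] -/
theorem false_of_caseCLeafT_all {N : ℕ} {A B C : Fin N → Finset (ZMod p)} (hS : IsSTPP A B C)
    (hA : ∀ k, (A k).Nonempty) (hB : ∀ k, (B k).Nonempty) (hC : ∀ k, (C k).Nonempty) (i : Fin N)
    {b c L z : ℕ} (hb : #(B i) = b) (hc : #(C i) = c)
    (hL : ∑ k ∈ univ.erase i, #(B k) * #(C k) = L) (hzp : z + 1 ≤ p)
    (hT : #((B i).image (fun x => (0 : ZMod p) - x) + DU A C (univ.erase i)) = b + z)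
    (hpart : (((A i) ×ˢ ((B i) ×ˢ (C i))).image fun q : ZMod p × ZMod p × ZMod p => (0 : ZMod p) + q.2.2 - q.1 - q.2.1) ∪
        ((A i).image (fun x => (0 : ZMod p) - x) + DU B C (univ.erase i)) ∪ ((B i).image (fun x => (0 : ZMod p) - x) + DU A C (univ.erase i)) = univ)
    {h₀ : ℕ} (hZ : DU A C (univ.erase i) = ((Finset.range (z + 1)).erase h₀).image fun t : ℕ => (t : ZMod p))
    (P Q : List ℕ) (hPmem : ∀ v, v ∈ P ↔ ∃ x ∈ A i, x.val = v) (hPnd : P.Nodup) (hQmem : ∀ v, v ∈ Q ↔ ∃ x ∈ B i, x.val = v)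
    (hQnd : Q.Nodup) (ks : List (Fin N)) (hks : ks.Nodup) (hksi : ∀ k, k ∈ ks ↔ k ≠ i) {szs : List (ℕ × ℕ × ℕ)}
    (hszs : ks.map (fun k => (#(A k), #(B k), #(C k))) = szs)
    {tbl : List (List ℕ × List ℕ)} (hdead : ∀ e ∈ tbl, CoverDead p N i szs e.1 e.2)
    (hall : (pattPQ p P Q).Nodup →
      popc (List.range p) (Q.foldl (fun m q => m ||| rot p (maskOf ((List.range (z + 1)).filter fun t => !(Nat.beq t h₀))) (p - q)) 0) =
        Q.length + z →
      ∀ rs : List (ℕ × ℕ), rs.Sublist (transMasks p (pattPQ p P Q)) → rs.length = c →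
        admissible (Q.foldl (fun m q => m ||| rot p (maskOf ((List.range (z + 1)).filter fun t => !(Nat.beq t h₀))) (p - q)) 0) rs = true →
        rs.foldl (fun cv x => cv ||| x.2)
          (Q.foldl (fun m q => m ||| rot p (maskOf ((List.range (z + 1)).filter fun t => !(Nat.beq t h₀))) (p - q)) 0) < 2 ^ p →
        pruneC p L P (rs.foldl (fun cv x => cv ||| x.2)
          (Q.foldl (fun m q => m ||| rot p (maskOf ((List.range (z + 1)).filter fun t => !(Nat.beq t h₀))) (p - q)) 0)) = true →
        caseCLeafT p L P ((List.range (z + 1)).filter fun t => !(Nat.beq t h₀)) tbl (rs.map Prod.fst)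
          (rs.foldl (fun cv x => cv ||| x.2)
            (Q.foldl (fun m q => m ||| rot p (maskOf ((List.range (z + 1)).filter fun t => !(Nat.beq t h₀))) (p - q)) 0)) = true) :
    False := by
  have hp0 : 0 < p := hp.out.pos
  have hQlt : ∀ q ∈ Q, q < p := fun q hq => by obtain ⟨x, _, rfl⟩ := (hQmem q).1 hq; exact x.val_lt
  have hPlt : ∀ q ∈ P, q < p := fun q hq => by obtain ⟨x, _, rfl⟩ := (hPmem q).1 hq; exact x.val_lt
  have hQlen : Q.length = #(B i) := by
    rw [← List.toFinset_card_of_nodup hQnd, ← card_image_of_injective (B i) (ZMod.val_injective p)]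
    congr 1; ext v; rw [List.mem_toFinset, hQmem, mem_image]
  -- the pattern is duplicate-free
  set patt := pattPQ p P Q with hpattdef
  have hpatt_mem : ∀ w, w ∈ patt ↔ ∃ x ∈ A i, ∃ bb ∈ B i, (x.val + bb.val) % p = w := by
    intro w; rw [hpattdef, pattPQ, List.mem_flatMap]
    constructor
    · rintro ⟨xv, hxv, hw⟩
      rw [List.mem_map] at hw
      obtain ⟨q, hq, rfl⟩ := hw
      obtain ⟨x, hx, rfl⟩ := (hPmem xv).1 hxv
      obtain ⟨bb, hbb, rfl⟩ := (hQmem q).1 hq; exact ⟨x, hx, bb, hbb, rfl⟩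
    · rintro ⟨x, hx, bb, hbb, rfl⟩
      exact ⟨x.val, (hPmem _).2 ⟨x, hx, rfl⟩, List.mem_map.2 ⟨bb.val, (hQmem _).2 ⟨bb, hbb, rfl⟩, rfl⟩⟩
  have hpatt_cast : ∀ (x bb : ZMod p), ((((x.val + bb.val) % p : ℕ)) : ZMod p) = x + bb := fun x bb => by
    rw [cast_add_mod, ZMod.natCast_zmod_val, ZMod.natCast_zmod_val]
  have hpatt : patt.Nodup := by
    rw [hpattdef, pattPQ, List.nodup_flatMap]
    constructor
    · intro xv _
      refine List.Nodup.map_on (fun q hq q' hq' hqq => ?_) hQnd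
      have hq1 := hQlt q hq
      have hq2 := hQlt q' hq'
      have := congrArg (fun n : ℕ => (n : ZMod p)) hqq
      simp only [cast_add_mod, add_right_inj] at this
      have := congrArg ZMod.val this
      rwa [ZMod.val_natCast_of_lt hq1, ZMod.val_natCast_of_lt hq2] at this
    · refine hPnd.imp_of_mem ?_
      intro xv xv' hxv hxv' hne v hv hv'
      rw [List.mem_map] at hv hv'
      obtain ⟨q, hq, rfl⟩ := hv
      obtain ⟨q', hq', hqq⟩ := hv'
      obtain ⟨x, hx, rfl⟩ := (hPmem xv).1 hxv
      obtain ⟨x', hx', rfl⟩ := (hPmem xv').1 hxv'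
      obtain ⟨bb, hbb, rfl⟩ := (hQmem q).1 hq
      obtain ⟨bb', hbb', rfl⟩ := (hQmem q').1 hq'
      have hcast := congrArg (fun n : ℕ => (n : ZMod p)) hqq
      simp only [hpatt_cast] at hcast
      obtain ⟨hxx, -⟩ := add_injOn_AB hS hC i hx' hx hbb' hbb hcast; exact hne (by rw [hxx])
  -- the three sets
  set W := ((A i) ×ˢ ((B i) ×ˢ (C i))).image fun q : ZMod p × ZMod p × ZMod p => (0 : ZMod p) + q.2.2 - q.1 - q.2.1 with hW
  set SY := (A i).image (fun x => (0 : ZMod p) - x) + DU B C (univ.erase i) with hSYdef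
  set T := (B i).image (fun x => (0 : ZMod p) - x) + DU A C (univ.erase i) with hTdef
  have hWSY : Disjoint W SY := disjoint_W_negA_add_DU hS i
  have hTWSY : Disjoint T (W ∪ SY) := disjoint_negB_add_DU_AC hS i
  have hmemW : ∀ x ∈ A i, ∀ bb ∈ B i, ∀ cc ∈ C i, cc - x - bb ∈ W := fun x hx bb hbb cc hcc =>
    mem_image.2 ⟨(x, bb, cc), mem_product.2 ⟨hx, mem_product.2 ⟨hbb, hcc⟩⟩, by ring⟩
  have hpart' : ∀ e : ZMod p, e ∈ W ∨ e ∈ SY ∨ e ∈ T := by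
    intro e
    have : e ∈ W ∪ SY ∪ T := by rw [hpart]; exact mem_univ e
    simpa [mem_union, or_assoc] using this
  -- `Zo` and the mask of `T`
  set Zo := (List.range (z + 1)).filter fun t => !(Nat.beq t h₀) with hZodef
  have hZo_mem : ∀ v, v ∈ Zo ↔ ∃ ζ ∈ DU A C (univ.erase i), ζ.val = v := by
    intro v; rw [hZodef, List.mem_filter, List.mem_range, hZ]
    constructor
    · rintro ⟨hv, hne⟩
      refine ⟨(v : ZMod p), mem_image.2 ⟨v, mem_erase.2 ⟨fun hvh => ?_, mem_range.2 hv⟩, rfl⟩, ZMod.val_natCast_of_lt (by omega)⟩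
      rw [hvh, Nat.beq_refl] at hne; exact Bool.noConfusion hne
    · rintro ⟨ζ, hζ, rfl⟩
      obtain ⟨t, ht, rfl⟩ := mem_image.1 hζ
      rw [mem_erase, mem_range] at ht
      rw [ZMod.val_natCast_of_lt (by omega)]
      refine ⟨ht.2, ?_⟩
      cases hbq : Nat.beq t h₀
      · rfl
      · exact absurd (Nat.eq_of_beq_eq_true hbq) ht.1
  have hZo_lt : ∀ v ∈ Zo, v < p := fun v hv => by obtain ⟨ζ, _, rfl⟩ := (hZo_mem v).1 hv; exact ζ.val_lt
  have hZo_nd : Zo.Nodup := (List.nodup_range (n := z + 1)).filter _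
  set tM := Q.foldl (fun m q => m ||| rot p (maskOf Zo) (p - q)) 0 with htMdef
  have htM_mem : ∀ v, v < p → (tb tM v = true ↔ ∃ e ∈ T, e.val = v) := by
    intro v hv; rw [htMdef, tb_foldl_lor_rot (maskOf_lt_two_pow hZo_lt) hQlt hv]
    constructor
    · rintro ⟨q, hq, htb⟩
      obtain ⟨bb, hbb, rfl⟩ := (hQmem q).1 hq
      obtain ⟨ζ, hζ, hζv⟩ := (hZo_mem _).1 ((tb_maskOf _ _).1 htb)
      refine ⟨(0 - bb) + ζ, Finset.add_mem_add (mem_image.2 ⟨bb, hbb, rfl⟩) hζ, ?_⟩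
      have h' : ((((v + bb.val) % p : ℕ)) : ZMod p) = (v : ZMod p) + bb := by rw [cast_add_mod, ZMod.natCast_zmod_val]
      have hζe : ζ = (v : ZMod p) + bb := by
        have := congrArg (fun n : ℕ => (n : ZMod p)) hζv; simp only [ZMod.natCast_zmod_val, h'] at this; exact this
      rw [hζe, show (0 : ZMod p) - bb + ((v : ZMod p) + bb) = v by ring, ZMod.val_natCast_of_lt hv]
    · rintro ⟨e, he, hev⟩
      obtain ⟨nb, hnb, ζ, hζ, rfl⟩ := Finset.mem_add.1 he
      obtain ⟨bb, hbb, rfl⟩ := mem_image.1 hnb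
      refine ⟨bb.val, (hQmem _).2 ⟨bb, hbb, rfl⟩, (tb_maskOf _ _).2 ((hZo_mem _).2 ⟨ζ, hζ, ?_⟩)⟩
      have h' : ((((v + bb.val) % p : ℕ)) : ZMod p) = (v : ZMod p) + bb := by rw [cast_add_mod, ZMod.natCast_zmod_val]
      have hv' : (v : ZMod p) = 0 - bb + ζ := by rw [← hev, ZMod.natCast_zmod_val]
      have := congrArg ZMod.val (show ((((v + bb.val) % p : ℕ)) : ZMod p) = ζ by rw [h', hv']; ring)
      rw [ZMod.val_natCast, Nat.mod_eq_of_lt (Nat.mod_lt _ hp0)] at this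
      exact this.symm
  have htM_lt : tM < 2 ^ p := by
    refine Nat.lt_pow_two_of_testBit _ fun j hj => ?_
    rw [← tb_eq_testBit, Bool.eq_false_iff]
    intro htb
    rw [htMdef, tb_foldl_lor_fun] at htb
    rcases htb with htb | ⟨q, _, htb⟩
    · rw [tb_zero] at htb; exact Bool.noConfusion htb
    · rw [tb_eq_false_of_lt (rot_lt_two_pow p _ _) hj] at htb; exact Bool.noConfusion htb
  have htMcard : popc (List.range p) tM = Q.length + z := by
    rw [hQlen, hb, ← hT, popc_eq_length_members]
    have hnd : (members (List.range p) tM).Nodup := nodup_members List.nodup_range _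
    have hset : (members (List.range p) tM).toFinset = T.image ZMod.val := by
      ext v
      rw [List.mem_toFinset, mem_members, List.mem_range, mem_image]
      constructor
      · rintro ⟨hv, htb⟩; exact (htM_mem v hv).1 htb
      · rintro ⟨e, he, rfl⟩; exact ⟨e.val_lt, (htM_mem _ e.val_lt).2 ⟨e, he, rfl⟩⟩
    rw [← List.toFinset_card_of_nodup hnd, hset, card_image_of_injective _ (ZMod.val_injective p)]
  -- the tiling of ALL translates from the cover `T`
  have htrans_mem : ∀ (r w : ℕ) (cc : ZMod p), cc.val = r → w ∈ patt →
      ∃ x ∈ A i, ∃ bb ∈ B i, ((((r + p - w) % p : ℕ)) : ZMod p) = cc - x - bb := by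
    intro r w cc hr hw
    obtain ⟨x, hx, bb, hbb, rfl⟩ := (hpatt_mem w).1 hw
    refine ⟨x, hx, bb, hbb, ?_⟩
    rw [cast_add_sub_mod (by have := Nat.mod_lt (x.val + bb.val) hp0; omega), hpatt_cast, ← hr, ZMod.natCast_zmod_val]; ring
  set RS := (C i).image ZMod.val with hRS
  have hRSmem : ∀ r, r ∈ RS ↔ ∃ cc ∈ C i, cc.val = r := by intro r; rw [hRS, mem_image]
  obtain ⟨hsub, hlen, hadm, hmemrs⟩ := admissible_filter_transMasks_all p patt tM RS
    (by
      intro r hr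
      obtain ⟨cc, _, rfl⟩ := (hRSmem r).1 hr
      exact cc.val_lt)
    (by
      intro r hr w hw
      obtain ⟨cc, hcc, hr'⟩ := (hRSmem r).1 hr
      obtain ⟨x, hx, bb, hbb, hval⟩ := htrans_mem r w cc hr' hw
      have hinW : ((((r + p - w) % p : ℕ)) : ZMod p) ∈ W := by rw [hval]; exact hmemW x hx bb hbb cc hcc
      rw [Bool.eq_false_iff]
      intro htb
      obtain ⟨e, he, hev⟩ := (htM_mem _ (Nat.mod_lt _ hp0)).1 htb
      have hee : e = ((((r + p - w) % p : ℕ)) : ZMod p) := by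
        apply ZMod.val_injective p
        rw [hev, ZMod.val_natCast, Nat.mod_eq_of_lt (Nat.mod_lt _ hp0)]
      rw [hee] at he
      exact Finset.disjoint_left.1 hTWSY he (mem_union_left _ hinW))
    (by
      intro r hr r' hr' hne w hw w' hw' heq
      obtain ⟨cc, hcc, hrv⟩ := (hRSmem r).1 hr
      obtain ⟨cc', hcc', hrv'⟩ := (hRSmem r').1 hr'
      obtain ⟨x, hx, bb, hbb, hval⟩ := htrans_mem r w cc hrv hw
      obtain ⟨x', hx', bb', hbb', hval'⟩ := htrans_mem r' w' cc' hrv' hw'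
      rw [heq, hval'] at hval
      obtain ⟨-, -, hccc⟩ := blockSum_inj hS i hx' hx hbb' hbb hcc' hcc hval; exact hne (by rw [← hrv, ← hrv', hccc]))
  have hlen' : ((transMasks p patt).filter fun x => decide (x.1 ∈ RS)).length = c := by
    rw [hlen, hRS, Finset.card_image_of_injective _ (ZMod.val_injective p), hc]
  set rs := (transMasks p patt).filter fun x => decide (x.1 ∈ RS) with hrs
  -- the cover `W ∪ T`
  set cov := rs.foldl (fun cv x => cv ||| x.2) tM with hcov
  have hcov_mem : ∀ v, tb cov v = true ↔ ∃ e ∈ W ∪ T, e.val = v := by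
    intro v; rw [hcov, tb_foldl_lor]
    constructor
    · rintro (hv | ⟨x, hx, hv⟩)
      · have hvp : v < p := by
          by_contra hge
          rw [tb_eq_false_of_lt htM_lt (by omega)] at hv; exact Bool.noConfusion hv
        obtain ⟨e, he, hev⟩ := (htM_mem v hvp).1 hv
        exact ⟨e, mem_union_right _ he, hev⟩
      · obtain ⟨hx1, hxe⟩ := (hmemrs x).1 hx
        obtain ⟨cc, hcc, hrv⟩ := (hRSmem _).1 hx1
        rw [hxe] at hv
        obtain ⟨w, hw, hwv⟩ := (tb_transMask p patt x.1 _).1 hv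
        obtain ⟨x', hx', bb, hbb, hval⟩ := htrans_mem x.1 w cc hrv hw
        refine ⟨cc - x' - bb, mem_union_left _ (hmemW x' hx' bb hbb cc hcc), ?_⟩
        rw [← hval, ZMod.val_natCast, Nat.mod_mod, hwv]
    · rintro ⟨e, he, rfl⟩
      rcases mem_union.1 he with he | he
      · right
        obtain ⟨⟨x, bb, cc⟩, hq, rfl⟩ := mem_image.1 he
        simp only [mem_product] at hq
        obtain ⟨hx, hbb, hcc⟩ := hq
        have hwmem : (x.val + bb.val) % p ∈ patt := (hpatt_mem _).2 ⟨x, hx, bb, hbb, rfl⟩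
        refine ⟨(cc.val, maskOf (patt.map fun y => (cc.val + p - y) % p)), (hmemrs _).2 ⟨(hRSmem _).2 ⟨cc, hcc, rfl⟩, rfl⟩, ?_⟩
        rw [tb_transMask]
        refine ⟨_, hwmem, ?_⟩
        have h' : ((((cc.val + p - (x.val + bb.val) % p) % p : ℕ)) : ZMod p) = (0 : ZMod p) + cc - x - bb := by
          rw [cast_add_sub_mod (by have := Nat.mod_lt (x.val + bb.val) hp0; omega), hpatt_cast, ZMod.natCast_zmod_val]; ring
        have := congrArg ZMod.val h'
        rwa [ZMod.val_natCast, Nat.mod_eq_of_lt (Nat.mod_lt _ hp0)] at this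
      · left
        exact (htM_mem _ e.val_lt).2 ⟨e, he, rfl⟩
  have hcov_lt : cov < 2 ^ p := by
    refine Nat.lt_pow_two_of_testBit _ fun j hj => ?_; rw [← tb_eq_testBit, Bool.eq_false_iff]
    intro htb
    obtain ⟨e, _, hev⟩ := (hcov_mem j).1 htb
    have := e.val_lt; omega
  -- `SY` as the complement
  set sy := fullMask p ^^^ cov with hsydef
  have hsy_lt : sy < 2 ^ p := by
    rw [hsydef, fullMask_eq]; exact Nat.xor_lt_two_pow (by have := Nat.one_le_two_pow (n := p); omega) hcov_lt
  have hsy_mem : ∀ v, v < p → (tb sy v = true ↔ ∃ e ∈ SY, e.val = v) := by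
    intro v hv; rw [hsydef, tb_compl hv, Bool.not_eq_true']
    constructor
    · intro hcv
      have hnot : ¬ ∃ e ∈ W ∪ T, e.val = v := fun hh => by rw [(hcov_mem v).2 hh] at hcv; exact Bool.noConfusion hcv
      refine ⟨(v : ZMod p), ?_, ZMod.val_natCast_of_lt hv⟩
      rcases hpart' (v : ZMod p) with h1 | h2 | h3
      · exact absurd ⟨_, mem_union_left _ h1, ZMod.val_natCast_of_lt hv⟩ hnot
      · exact h2
      · exact absurd ⟨_, mem_union_right _ h3, ZMod.val_natCast_of_lt hv⟩ hnot
    · rintro ⟨e, he, hev⟩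
      rw [Bool.eq_false_iff]
      intro hcv
      obtain ⟨e', he', hev'⟩ := (hcov_mem v).1 hcv
      have : e' = e := ZMod.val_injective p (hev'.trans hev.symm)
      rw [this] at he'
      rcases mem_union.1 he' with h1 | h3
      · exact Finset.disjoint_left.1 hWSY h1 he
      · exact Finset.disjoint_left.1 hTWSY h3 (mem_union_right _ he)
  -- `Y° ⊆ Yc`
  have hmemSYel : ∀ x ∈ A i, ∀ yy ∈ DU B C (univ.erase i), yy - x ∈ SY := fun x hx yy hyy => by
    have hneg : (0 : ZMod p) - x ∈ (A i).image (fun t => (0 : ZMod p) - t) := mem_image.2 ⟨x, hx, rfl⟩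
    have := Finset.add_mem_add hneg hyy
    convert this using 1; ring
  set yc := P.foldl (fun m x => m &&& rot p sy x) (fullMask p) with hycdef
  have hYmem : ∀ yy ∈ DU B C (univ.erase i), yy.val ∈ members (List.range p) yc := by
    intro yy hyy; rw [mem_members, List.mem_range]
    refine ⟨yy.val_lt, ?_⟩
    rw [hycdef, tb_foldl_land_rot hsy_lt hPlt yy.val_lt]
    intro xv hxv
    obtain ⟨x, hx, rfl⟩ := (hPmem xv).1 hxv
    rw [hsy_mem _ (Nat.mod_lt _ hp0), val_sub_eq_mod]; exact ⟨yy - x, hmemSYel x hx yy hyy, rfl⟩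
  have hYcard : #(DU B C (univ.erase i)) = L := by rw [card_DU_BC hS hA, hL]
  set Yo := (members (List.range p) yc).filter fun v => decide (v ∈ (DU B C (univ.erase i)).image ZMod.val) with hYodef
  have hYo_sub : Yo ∈ (members (List.range p) yc).sublistsLen L := by
    rw [← hYcard, ← card_image_of_injective (DU B C (univ.erase i)) (ZMod.val_injective p)]
    exact filter_mem_sublistsLen _ (nodup_members List.nodup_range _) _ fun v hv => by
      obtain ⟨yy, hyy, rfl⟩ := mem_image.1 hv; exact hYmem yy hyy
  have hYo_mem : ∀ v, v ∈ Yo ↔ ∃ e ∈ DU B C (univ.erase i), e.val = v := by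
    intro v; rw [hYodef, List.mem_filter, decide_eq_true_eq, mem_image]
    constructor
    · exact fun h' => h'.2
    · rintro ⟨yy, hyy, rfl⟩; exact ⟨hYmem yy hyy, yy, hyy, rfl⟩
  have hYo_nd : Yo.Nodup := (nodup_members List.nodup_range _).filter _
  have hYo_lt : ∀ v ∈ Yo, v < p := fun v hv => by obtain ⟨e, _, rfl⟩ := (hYo_mem v).1 hv; exact e.val_lt
  have hsyM : P.foldl (fun m x => m ||| rot p (maskOf Yo) (p - x)) 0 = sy := by
    apply Nat.eq_of_testBit_eq
    intro j; rw [← tb_eq_testBit, ← tb_eq_testBit]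
    by_cases hj : j < p
    · rw [Bool.eq_iff_iff, tb_foldl_lor_rot (maskOf_lt_two_pow hYo_lt) hPlt hj, hsy_mem j hj]
      constructor
      · rintro ⟨xv, hxv, htb⟩
        obtain ⟨x, hx, rfl⟩ := (hPmem xv).1 hxv
        obtain ⟨yy, hyy, hyv⟩ := (hYo_mem _).1 ((tb_maskOf _ _).1 htb)
        refine ⟨yy - x, hmemSYel x hx yy hyy, ?_⟩
        have h' : ((((j + x.val) % p : ℕ)) : ZMod p) = (j : ZMod p) + x := by rw [cast_add_mod, ZMod.natCast_zmod_val]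
        have hye : yy = (j : ZMod p) + x := by
          have := congrArg (fun n : ℕ => (n : ZMod p)) hyv; simp only [ZMod.natCast_zmod_val, h'] at this; exact this
        rw [hye, show (j : ZMod p) + x - x = j by ring, ZMod.val_natCast_of_lt hj]
      · rintro ⟨e, he, hev⟩
        obtain ⟨nx, hnx, yy, hyy, rfl⟩ := Finset.mem_add.1 he
        obtain ⟨x, hx, rfl⟩ := mem_image.1 hnx
        refine ⟨x.val, (hPmem _).2 ⟨x, hx, rfl⟩, (tb_maskOf _ _).2 ((hYo_mem _).2 ⟨yy, hyy, ?_⟩)⟩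
        have h' : ((((j + x.val) % p : ℕ)) : ZMod p) = (j : ZMod p) + x := by rw [cast_add_mod, ZMod.natCast_zmod_val]
        have hv' : (j : ZMod p) = 0 - x + yy := by rw [← hev, ZMod.natCast_zmod_val]
        have := congrArg ZMod.val (show ((((j + x.val) % p : ℕ)) : ZMod p) = yy by rw [h', hv']; ring)
        rw [ZMod.val_natCast, Nat.mod_eq_of_lt (Nat.mod_lt _ hp0)] at this
        exact this.symm
    · rw [not_lt] at hj
      have h1' : tb (P.foldl (fun m x => m ||| rot p (maskOf Yo) (p - x)) 0) j = false := by
        rw [Bool.eq_false_iff]; intro htb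
        rw [tb_foldl_lor_fun] at htb
        rcases htb with htb | ⟨q, _, htb⟩
        · rw [tb_zero] at htb; exact Bool.noConfusion htb
        · rw [tb_eq_false_of_lt (rot_lt_two_pow p _ _) hj] at htb; exact Bool.noConfusion htb
      rw [h1', tb_eq_false_of_lt hsy_lt hj]
  -- the prune holds at the final cover
  have hprune : pruneC p L P cov = true := by
    unfold pruneC
    rw [Nat.ble_eq, popc_eq_length_members]
    have hsl := List.mem_sublistsLen.1 hYo_sub
    have := hsl.1.length_le
    rw [hsl.2] at this
    exact this
  -- the leaf is reached with the true `(Yo, Zo)`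
  have hleaf := hall hpatt htMcard rs hsub hlen' hadm hcov_lt hprune
  have hmem := mem_of_caseCLeafT hleaf Yo hYo_sub hsyM
  exact hdead _ hmem A B C hS hA hB hC ks hks hksi hszs hYo_nd hZo_nd hYo_mem hZo_mem

/-- **NORMAL-FORM SOUNDNESS of `caseCDeadT`** (pinned-`Z°` gauge, any number of blocks). [cite: CohnKleinbergSzegedyUmans2005, Def. 5.1]
[cite: HamidouneRodseth2000, main theorem (§1, p. 252)] -/
theorem caseCDeadT_false_of_normal_form {N : ℕ} {A B C : Fin N → Finset (ZMod p)} (hS : IsSTPP A B C)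
    (hA : ∀ k, (A k).Nonempty) (hB : ∀ k, (B k).Nonempty) (hC : ∀ k, (C k).Nonempty) (i : Fin N)
    {b c L z : ℕ} (hb : #(B i) = b) (hc : #(C i) = c)
    (hL : ∑ k ∈ univ.erase i, #(B k) * #(C k) = L) (hzp : z + 1 ≤ p)
    (hT : #((B i).image (fun x => (0 : ZMod p) - x) + DU A C (univ.erase i)) = b + z)
    (hpart : (((A i) ×ˢ ((B i) ×ˢ (C i))).image fun q : ZMod p × ZMod p × ZMod p => (0 : ZMod p) + q.2.2 - q.1 - q.2.1) ∪
        ((A i).image (fun x => (0 : ZMod p) - x) + DU B C (univ.erase i)) ∪ ((B i).image (fun x => (0 : ZMod p) - x) + DU A C (univ.erase i)) = univ)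
    {h₀ : ℕ} (hZ : DU A C (univ.erase i) = ((Finset.range (z + 1)).erase h₀).image fun t : ℕ => (t : ZMod p))
    (P Q : List ℕ) (hPmem : ∀ v, v ∈ P ↔ ∃ x ∈ A i, x.val = v) (hPnd : P.Nodup) (hQmem : ∀ v, v ∈ Q ↔ ∃ x ∈ B i, x.val = v)
    (hQnd : Q.Nodup) (ks : List (Fin N)) (hks : ks.Nodup) (hksi : ∀ k, k ∈ ks ↔ k ≠ i) {szs : List (ℕ × ℕ × ℕ)}
    (hszs : ks.map (fun k => (#(A k), #(B k), #(C k))) = szs)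
    {tbl : List (List ℕ × List ℕ)} (hdead : ∀ e ∈ tbl, CoverDead p N i szs e.1 e.2) :
    caseCDeadT p c L z Q P h₀ tbl = false := by
  rw [Bool.eq_false_iff]; intro h
  exact false_of_caseCLeafT_all hS hA hB hC i hb hc hL hzp hT hpart hZ P Q hPmem hPnd hQmem hQnd ks hks hksi hszs hdead
    (fun hpatt hTc rs hsub hlen hadm _ _ => caseCLeafT_of_caseCDeadT h hpatt hTc rs hsub hlen hadm)

/-- **NORMAL-FORM SOUNDNESS of the pruned checker `caseCDeadTP`** (pinned-`Z°` gauge, any number of blocks). [cite: CohnKleinbergSzegedyUmans2005, Def. 5.1]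
[cite: HamidouneRodseth2000, main theorem (§1, p. 252)] -/
theorem caseCDeadTP_false_of_normal_form {N : ℕ} {A B C : Fin N → Finset (ZMod p)} (hS : IsSTPP A B C)
    (hA : ∀ k, (A k).Nonempty) (hB : ∀ k, (B k).Nonempty) (hC : ∀ k, (C k).Nonempty) (i : Fin N)
    {b c L z : ℕ} (hb : #(B i) = b) (hc : #(C i) = c)
    (hL : ∑ k ∈ univ.erase i, #(B k) * #(C k) = L) (hzp : z + 1 ≤ p)
    (hT : #((B i).image (fun x => (0 : ZMod p) - x) + DU A C (univ.erase i)) = b + z)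
    (hpart : (((A i) ×ˢ ((B i) ×ˢ (C i))).image fun q : ZMod p × ZMod p × ZMod p => (0 : ZMod p) + q.2.2 - q.1 - q.2.1) ∪
        ((A i).image (fun x => (0 : ZMod p) - x) + DU B C (univ.erase i)) ∪ ((B i).image (fun x => (0 : ZMod p) - x) + DU A C (univ.erase i)) = univ)
    {h₀ : ℕ} (hZ : DU A C (univ.erase i) = ((Finset.range (z + 1)).erase h₀).image fun t : ℕ => (t : ZMod p))
    (P Q : List ℕ) (hPmem : ∀ v, v ∈ P ↔ ∃ x ∈ A i, x.val = v) (hPnd : P.Nodup) (hQmem : ∀ v, v ∈ Q ↔ ∃ x ∈ B i, x.val = v)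
    (hQnd : Q.Nodup) (ks : List (Fin N)) (hks : ks.Nodup) (hksi : ∀ k, k ∈ ks ↔ k ≠ i) {szs : List (ℕ × ℕ × ℕ)}
    (hszs : ks.map (fun k => (#(A k), #(B k), #(C k))) = szs)
    {tbl : List (List ℕ × List ℕ)} (hdead : ∀ e ∈ tbl, CoverDead p N i szs e.1 e.2) :
    caseCDeadTP p c L z Q P h₀ tbl = false := by
  rw [Bool.eq_false_iff]; intro h
  have hPlt : ∀ q ∈ P, q < p := fun q hq => by obtain ⟨x, _, rfl⟩ := (hPmem q).1 hq; exact x.val_lt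
  exact false_of_caseCLeafT_all hS hA hB hC i hb hc hL hzp hT hpart hZ P Q hPmem hPnd hQmem hQnd ks hks hksi hszs hdead
    (fun hpatt hTc rs hsub hlen hadm hlt hfin => caseCLeafT_of_caseCDeadTP h hpatt hPlt hTc rs hsub hlen hadm hlt hfin)

end Summit.MatrixMultiplication.OmegaCensus.CubeNB.S2
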